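import Summits.BirchSwinnertonDyer.BirchSwinnertonDyer.Theorems.SignedLowerHalvesSmallImageLowerHalfBothSignsRttD2SeqJ3TorsionLevels
import Summits.BirchSwinnertonDyer.BirchSwinnertonDyer.Theorems.SignedLowerHalvesSmallImageLowerHalfBothSignsRttD2SeqJ3LocalPairing
import Summits.BirchSwinnertonDyer.BirchSwinnertonDyer.Theorems.SignedLowerHalvesSmallImageLowerHalfBothSignsRttD2SeqLocalCondition
import Literature.NumberTheory.GaloisRepresentations.ContinuousShapiroLiftRestrictHom
import Literature.NumberTheory.EllipticCurves.GreenbergVatsal2000.UnramifiedOutsideFinite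
import Literature.NumberTheory.EllipticCurves.SubgroupSelmerCocycleCriteriaProofs
import HarnessLib

/-!
# Route `SignedLowerHalves`, crux L `SmallImageLowerHalfBothSigns` (stmt-BirchSwinnertonDyer-23599), line `rtt_w3` v15 — E2, row J3 residual
# (`RSeq`), brick R5: THE `M[p^k]`-SIDE OF THE RECIPROCITY — localisation of GLOBAL torsion-level classes `b ∈ H¹(U_n, M[p^k])` along `U_{n,v} → U_n`
# (`θ_{U_n,v}^*`, the second argument of R2/R3), its compatibility with `torsToH1` / `torsIncl` / g22's `locH1Layer`, ADMISSIBILITY of such `b` off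
# `S₀ ∪ {p} ∪ P` (it dies on `U_n ⊓ I_𝔓` when its image in `H¹(U_n, M)` is unramified there and inertia acts trivially on `M`), and the LIFT of a local
# torsion-level lift `ℓ` of `loc_{v,n} c` to the localisation of a GLOBAL torsion-level lift of `c` (after raising the level)

WIDTH seat `bsd-line-slh-p3-w3` g23 under LEAD `cruxlead-stmt-BirchSwinnertonDyer-23599` g11 (cell `bsd-ssimc`); helper `--supports stmt-BirchSwinnertonDyer-23599`.
THEOREMS ONLY; no definition, no named fact, no instance, no `sorry`. The `Γ_{K_v}`-action on `M` is the canonical one, `localAction (closureEmb K_v) M` (restriction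
along `res_v`; the LEAD's filler in `CharRoadTails`), activated by `letI` inside each statement — then the local `torsRep`/`subgroupH1` of g22's J3 files ARE the
restrictions of the global ones (definitionally). HONEST FRAMING: cohomological bookkeeping (Serre I §2, §5.1; NSW I §5) + one use of the tree's Greenberg–Vatsal lemma
`resOfLe_inertia_inf_eq_zero_of_mem_unramifiedOutside`; nothing about any curve; E2, crux L, crux M, BSD remain OPEN and are proved for NO curve.

* `torsToH1_map_comapSubtypeHom` (`torsToH1 ∘ θ^* = loc_{v,n} ∘ torsToH1`), `map_comapSubtypeHom_torsIncl` (`θ^* ∘ torsIncl = torsIncl ∘ θ^*`).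
* ★ `resLe_inf_inertia_eq_zero_of_torsToH1_mem_unramifiedOutside` — ADMISSIBILITY: `b ∈ H¹(U_n, M[p^k])` with `torsToH1 b ∈ unramifiedOutside U_n M p S₀` dies on `U_n ⊓ I_𝔓`
  for every prime `𝔓` over a place `w ∉ S₀`, `p ∉ w`, at which inertia acts trivially on `M` (`H¹(U ⊓ I, M[p^k]) → H¹(U ⊓ I, M)` is injective there).
* ★★ `exists_torsIncl_eq_map_comapSubtypeHom` — LIFT: for `c ∈ H¹(U_n, M)` and a local `ℓ ∈ H¹(U_{n,v}, M[p^k])` with `torsToH1 ℓ = loc_{v,n} c` there are `k′ ≥ k` and a GLOBAL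
  `b ∈ H¹(U_n, M[p^{k′}])` with `torsToH1 b = c` and `torsIncl ℓ = θ_{U_n,v}^* b` (exhaustion + kernel control, g22 p785597, on the compact groups `U_n`, `U_{n,v}`).
References: [SerreGaloisCohomology1997] I §2.2, §2.4, §5.1; [NeukirchSchmidtWingberg2008] I §5; [Rubin2000] §4.2, App. B.2; [GreenbergVatsal2000] §2 pp. 16–17.
-/

set_option autoImplicit false
set_option linter.dupNamespace false -- D-0017: single-problem summit, the namespace repeats the problem name by design
noncomputable section

open scoped Classical
open NumberField IsDedekindDomain Field CategoryTheory Function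

namespace Summit.BirchSwinnertonDyer.BirchSwinnertonDyer.Theorems.SmallImageRttD2Seq

open Literature.NumberTheory.EllipticCurves Literature.NumberTheory.GaloisRepresentations Literature.NumberTheory.EllipticCurves.GreenbergVatsal2000

section Tors

variable {K : Type} [Field K] [NumberField K] {p : ℕ} [Fact p.Prime] (κ : ZpExtension K p) (v : HeightOneSpectrum (𝓞 K))
  (M : Type) [AddCommGroup M] [TopologicalSpace M] [DiscreteTopology M] [DistribMulAction (absoluteGaloisGroup K) M]
  (hstabK : ∀ m : M, IsOpen (MulAction.stabilizer (absoluteGaloisGroup K) m : Set (absoluteGaloisGroup K)))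

/-- **`torsToH1 ∘ θ_{U_n,v}^* = loc_{v,n} ∘ torsToH1`** on `H¹(U_n, M[p^k])`: restricting a global torsion-level class along `U_{n,v} → U_n` and then passing to `M`-coefficients
is g22's `locH1Layer` of its image in `H¹(U_n, M)` (both are the map of the pair `(res_v, M[p^k] ⊆ M)`). [cite: SerreGaloisCohomology1997, I §2.4] -/
theorem torsToH1_map_comapSubtypeHom (n k : ℕ) (b : subgroupH1 (κ.layerSubgroup n) ↥(torsionPow M p k)) :
    letI := localAction (closureEmb (K := K) (v.adicCompletion K)) M
    torsToH1 M p (localSubgroupOfEmb (κ.layerSubgroup n) (closureEmb (K := K) (v.adicCompletion K))) k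
        (ContinuousCohomology.map (comapSubtypeHom (κ.layerSubgroup n) (resGalOfEmb (closureEmb (K := K) (v.adicCompletion K))))
          (comapCoeffHom (torsRep M hstabK p k).toTopRep (κ.layerSubgroup n) (resGalOfEmb (closureEmb (K := K) (v.adicCompletion K)))) 1 b) =
      locH1Layer κ M v (fun _ _ ↦ rfl) n (torsToH1 M p (κ.layerSubgroup n) k b) := by
  letI := localAction (closureEmb (K := K) (v.adicCompletion K)) M
  rw [torsToH1, torsToH1, locH1Layer, resH1Hom, resH1Hom, resH1Hom]
  change ContinuousCohomology.map _ _ 1 (ContinuousCohomology.map _ _ 1 b) = ContinuousCohomology.map _ _ 1 (ContinuousCohomology.map _ _ 1 b)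
  have e1 := map_comp_apply_of (X := discreteTopRep (κ.layerSubgroup n) ↥(torsionPow M p k))
    (comapSubtypeHom (κ.layerSubgroup n) (resGalOfEmb (closureEmb (K := K) (v.adicCompletion K))))
    (ContinuousMonoidHom.id _) (resGalSubgroupOfEmb (κ.layerSubgroup n) (closureEmb (K := K) (v.adicCompletion K))) (fun _ ↦ rfl)
    (comapCoeffHom (torsRep M hstabK p k).toTopRep (κ.layerSubgroup n) (resGalOfEmb (closureEmb (K := K) (v.adicCompletion K))))
    (resHomOfEquivariant (ContinuousMonoidHom.id _) (torsionPow M p k).subtype fun _ _ ↦ rfl)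
    (resHomOfEquivariant (resGalSubgroupOfEmb (κ.layerSubgroup n) (closureEmb (K := K) (v.adicCompletion K))) (torsionPow M p k).subtype fun _ _ ↦ rfl)
    (fun _ ↦ rfl) 1 b
  have e2 := map_comp_apply_of (X := discreteTopRep (κ.layerSubgroup n) ↥(torsionPow M p k))
    (ContinuousMonoidHom.id _) (resGalSubgroupOfEmb (κ.layerSubgroup n) (closureEmb (K := K) (v.adicCompletion K)))
    (resGalSubgroupOfEmb (κ.layerSubgroup n) (closureEmb (K := K) (v.adicCompletion K))) (fun _ ↦ rfl)
    (resHomOfEquivariant (ContinuousMonoidHom.id _) (torsionPow M p k).subtype fun _ _ ↦ rfl)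
    (resHomOfEquivariant (resGalSubgroupOfEmb (κ.layerSubgroup n) (closureEmb (K := K) (v.adicCompletion K))) (AddMonoidHom.id M) fun _ _ ↦ rfl)
    (resHomOfEquivariant (resGalSubgroupOfEmb (κ.layerSubgroup n) (closureEmb (K := K) (v.adicCompletion K))) (torsionPow M p k).subtype fun _ _ ↦ rfl)
    (fun _ ↦ rfl) 1 b
  exact e1.symm.trans e2

/-- **`θ_{U_n,v}^* ∘ torsIncl = torsIncl ∘ θ_{U_n,v}^*`** (raising the torsion level commutes with localisation; both are the map of the pair `(res_v, M[p^k] ⊆ M[p^{k′}])`).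
[cite: SerreGaloisCohomology1997, I §2.4] -/
theorem map_comapSubtypeHom_torsIncl (n : ℕ) {k k' : ℕ} (h : k ≤ k') (b : subgroupH1 (κ.layerSubgroup n) ↥(torsionPow M p k)) :
    letI := localAction (closureEmb (K := K) (v.adicCompletion K)) M
    ContinuousCohomology.map (comapSubtypeHom (κ.layerSubgroup n) (resGalOfEmb (closureEmb (K := K) (v.adicCompletion K))))
        (comapCoeffHom (torsRep M hstabK p k').toTopRep (κ.layerSubgroup n) (resGalOfEmb (closureEmb (K := K) (v.adicCompletion K)))) 1
        (torsIncl M p (κ.layerSubgroup n) h b) =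
      torsIncl M p (localSubgroupOfEmb (κ.layerSubgroup n) (closureEmb (K := K) (v.adicCompletion K))) h
        (ContinuousCohomology.map (comapSubtypeHom (κ.layerSubgroup n) (resGalOfEmb (closureEmb (K := K) (v.adicCompletion K))))
          (comapCoeffHom (torsRep M hstabK p k).toTopRep (κ.layerSubgroup n) (resGalOfEmb (closureEmb (K := K) (v.adicCompletion K)))) 1 b) := by
  letI := localAction (closureEmb (K := K) (v.adicCompletion K)) M
  rw [torsIncl, torsIncl, resH1Hom, resH1Hom]
  change ContinuousCohomology.map _ _ 1 (ContinuousCohomology.map _ _ 1 b) = ContinuousCohomology.map _ _ 1 (ContinuousCohomology.map _ _ 1 b)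
  have e1 := map_comp_apply_of (X := discreteTopRep (κ.layerSubgroup n) ↥(torsionPow M p k))
    (ContinuousMonoidHom.id _) (comapSubtypeHom (κ.layerSubgroup n) (resGalOfEmb (closureEmb (K := K) (v.adicCompletion K))))
    (resGalSubgroupOfEmb (κ.layerSubgroup n) (closureEmb (K := K) (v.adicCompletion K))) (fun _ ↦ rfl)
    (resHomOfEquivariant (ContinuousMonoidHom.id _) (AddSubgroup.inclusion (torsionPow_mono (M := M) (p := p) h)) fun _ _ ↦ rfl)
    (comapCoeffHom (torsRep M hstabK p k').toTopRep (κ.layerSubgroup n) (resGalOfEmb (closureEmb (K := K) (v.adicCompletion K))))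
    (resHomOfEquivariant (resGalSubgroupOfEmb (κ.layerSubgroup n) (closureEmb (K := K) (v.adicCompletion K)))
      (AddSubgroup.inclusion (torsionPow_mono (M := M) (p := p) h)) fun _ _ ↦ rfl)
    (fun _ ↦ rfl) 1 b
  have e2 := map_comp_apply_of (X := discreteTopRep (κ.layerSubgroup n) ↥(torsionPow M p k))
    (comapSubtypeHom (κ.layerSubgroup n) (resGalOfEmb (closureEmb (K := K) (v.adicCompletion K)))) (ContinuousMonoidHom.id _)
    (resGalSubgroupOfEmb (κ.layerSubgroup n) (closureEmb (K := K) (v.adicCompletion K))) (fun _ ↦ rfl)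
    (comapCoeffHom (torsRep M hstabK p k).toTopRep (κ.layerSubgroup n) (resGalOfEmb (closureEmb (K := K) (v.adicCompletion K))))
    (resHomOfEquivariant (ContinuousMonoidHom.id _) (AddSubgroup.inclusion (torsionPow_mono (M := M) (p := p) h)) fun _ _ ↦ rfl)
    (resHomOfEquivariant (resGalSubgroupOfEmb (κ.layerSubgroup n) (closureEmb (K := K) (v.adicCompletion K)))
      (AddSubgroup.inclusion (torsionPow_mono (M := M) (p := p) h)) fun _ _ ↦ rfl)
    (fun _ ↦ rfl) 1 b
  exact e1.symm.trans e2

/-- ★ **ADMISSIBILITY of a global torsion-level class off `S₀ ∪ {p} ∪ (ramification of M)`**: if `b ∈ H¹(U_n, M[p^k])` maps to a class of `H¹(U_n, M)` unramified outside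
`S₀ ∪ {w ∣ p}` (Greenberg–Vatsal, all conjugates), then for every finite place `w ∉ S₀` with `p ∉ w` at which the inertia groups act trivially on `M` and every prime `𝔓` over
`w`, `res_{U_n ⊓ I_𝔓} b = 0`: by `resOfLe_inertia_inf_eq_zero_of_mem_unramifiedOutside` the `M`-valued cocycle is principal on `I_𝔓 ∩ U_n`, i.e. ZERO there (trivial
action), so the `M[p^k]`-valued cocycle vanishes there too. This is the hypothesis "`b` dies on `U ⊓ I_𝔓` off `T`" of R3.
[cite: GreenbergVatsal2000, §2 pp. 16–17] [cite: SerreGaloisCohomology1997, I §5.1] -/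
theorem resLe_inf_inertia_eq_zero_of_torsToH1_mem_unramifiedOutside (n k : ℕ) {S₀ : Set (HeightOneSpectrum (𝓞 K))}
    (b : subgroupH1 (κ.layerSubgroup n) ↥(torsionPow M p k)) (hb : torsToH1 M p (κ.layerSubgroup n) k b ∈ unramifiedOutside (κ.layerSubgroup n) M p S₀)
    {w : HeightOneSpectrum (𝓞 K)} (hw : w ∉ S₀) (hwp : ((p : ℕ) : 𝓞 K) ∉ w.asIdeal) {𝔓 : Ideal (absIntegers (𝓞 K) K)} (h𝔓 : 𝔓 ∈ w.primesAbove)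
    (hI : ∀ τ ∈ 𝔓.inertia (absoluteGaloisGroup K), ∀ m : M, τ • m = m) :
    resLe (torsRep M hstabK p k).toTopRep (inf_le_left : κ.layerSubgroup n ⊓ 𝔓.inertia (absoluteGaloisGroup K) ≤ κ.layerSubgroup n) 1 b = 0 := by
  obtain ⟨β, rfl⟩ := oneCocycleClass_surjective (discreteTopRep (κ.layerSubgroup n) ↥(torsionPow M p k)) b
  -- the `M`-valued cocycle is principal, hence zero, on `I_𝔓 ∩ U_n`
  have hM := resOfLe_inertia_inf_eq_zero_of_mem_unramifiedOutside hb hw hwp h𝔓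
  rw [torsToH1_oneCocycleClass, CocycleCriteria.resOfLe_oneCocycleClass_eq_zero_iff] at hM
  obtain ⟨a, ha⟩ := hM
  have key : resOfLe ↥(torsionPow M p k) (inf_le_left : κ.layerSubgroup n ⊓ 𝔓.inertia (absoluteGaloisGroup K) ≤ κ.layerSubgroup n)
      (oneCocycleClass _ β) = 0 := by
    rw [CocycleCriteria.resOfLe_oneCocycleClass_eq_zero_iff]
    refine ⟨0, fun x ↦ ?_⟩
    have hxI : (x : absoluteGaloisGroup K) ∈ 𝔓.inertia (absoluteGaloisGroup K) := (Subgroup.mem_inf.mp x.2).2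
    have h1 := ha ⟨x, Subgroup.mem_inf.mpr ⟨hxI, (Subgroup.mem_inf.mp x.2).1⟩⟩
    rw [contOneCocycles.pullback_apply] at h1
    have h2 : ((β.1 (Subgroup.inclusion (inf_le_left : κ.layerSubgroup n ⊓ 𝔓.inertia (absoluteGaloisGroup K) ≤ κ.layerSubgroup n) x) : M)) =
        (x : absoluteGaloisGroup K) • a - a := h1
    rw [hI _ hxI a, sub_self] at h2
    rw [smul_zero, sub_zero]
    exact Subtype.ext h2
  exact key

/-- `torsIncl` composes along `k ≤ k′ ≤ k″` (any topological group; the local-tower version is g22's `torsIncl_trans`). [folklore] -/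
theorem torsIncl_torsIncl {G : Type} [Group G] [TopologicalSpace G] [IsTopologicalGroup G] {N : Type} [AddCommGroup N] [DistribMulAction G N]
    [TopologicalSpace N] [DiscreteTopology N] {q : ℕ} (U : Subgroup G) {k k' k'' : ℕ} (h : k ≤ k') (h' : k' ≤ k'') (ℓ : subgroupH1 U ↥(torsionPow N q k)) :
    torsIncl N q U h' (torsIncl N q U h ℓ) = torsIncl N q U (h.trans h') ℓ := by
  rw [← AddMonoidHom.comp_apply, torsIncl, torsIncl, torsIncl, resH1Hom_comp]
  exact DFunLike.congr_fun (resH1Hom_congr rfl (by ext; rfl) _ _) ℓ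

/-- ★★ **LIFTING A LOCAL TORSION-LEVEL LIFT TO A GLOBAL ONE (after raising the level).** For `c ∈ H¹(U_n, M)` (`M` discrete, `p`-primary) and a local class
`ℓ ∈ H¹(U_{n,v}, M[p^k])` with `torsToH1 ℓ = loc_{v,n} c`, there are `k′ ≥ k` and a GLOBAL `b ∈ H¹(U_n, M[p^{k′}])` with `torsToH1 b = c` and `torsIncl ℓ = θ_{U_n,v}^* b`:
`c` lifts to some torsion level (exhaustion on the compact `U_n`, `exists_torsToH1_eq`), the difference of the two local lifts dies in `H¹(U_{n,v}, M)` hence at a higher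
torsion level (kernel control, `exists_torsIncl_eq_zero_of_torsToH1_eq_zero`). [cite: SerreGaloisCohomology1997, I §2.2] [cite: Rubin2000, App. B.2] -/
theorem exists_torsIncl_eq_map_comapSubtypeHom (htor : ∀ m : M, ∃ k : ℕ, p ^ k • m = 0) (n k : ℕ) (c : subgroupH1 (κ.layerSubgroup n) M)
    (ℓ : letI := localAction (closureEmb (K := K) (v.adicCompletion K)) M
      subgroupH1 (localSubgroupOfEmb (κ.layerSubgroup n) (closureEmb (K := K) (v.adicCompletion K))) ↥(torsionPow M p k))
    (hℓ : letI := localAction (closureEmb (K := K) (v.adicCompletion K)) M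
      torsToH1 M p _ k ℓ = locH1Layer κ M v (fun _ _ ↦ rfl) n c) :
    letI := localAction (closureEmb (K := K) (v.adicCompletion K)) M
    ∃ (k' : ℕ) (h : k ≤ k') (b : subgroupH1 (κ.layerSubgroup n) ↥(torsionPow M p k')), torsToH1 M p (κ.layerSubgroup n) k' b = c ∧
      torsIncl M p (localSubgroupOfEmb (κ.layerSubgroup n) (closureEmb (K := K) (v.adicCompletion K))) h ℓ =
        ContinuousCohomology.map (comapSubtypeHom (κ.layerSubgroup n) (resGalOfEmb (closureEmb (K := K) (v.adicCompletion K))))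
          (comapCoeffHom (torsRep M hstabK p k').toTopRep (κ.layerSubgroup n) (resGalOfEmb (closureEmb (K := K) (v.adicCompletion K)))) 1 b := by
  letI := localAction (closureEmb (K := K) (v.adicCompletion K)) M
  haveI : CompactSpace (absoluteGaloisGroup K) := absoluteGaloisGroup_compactSpace _
  haveI : CompactSpace ↥(κ.layerSubgroup n) := isCompact_iff_compactSpace.mp (Subgroup.isClosed_of_isOpen _ (κ.isOpen_layerSubgroup n)).isCompact
  -- a global lift of `c` at some level `j`
  obtain ⟨j, bj, hbj⟩ := exists_torsToH1_eq (κ.layerSubgroup n) htor c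
  -- compare the two local lifts at level `max k j`
  set k₁ := max k j with hk₁
  set b₁ : subgroupH1 (localSubgroupOfEmb (κ.layerSubgroup n) (closureEmb (K := K) (v.adicCompletion K))) ↥(torsionPow M p k₁) :=
    ContinuousCohomology.map (comapSubtypeHom (κ.layerSubgroup n) (resGalOfEmb (closureEmb (K := K) (v.adicCompletion K))))
      (comapCoeffHom (torsRep M hstabK p k₁).toTopRep (κ.layerSubgroup n) (resGalOfEmb (closureEmb (K := K) (v.adicCompletion K)))) 1
      (torsIncl M p (κ.layerSubgroup n) (le_max_right k j) bj) with hb₁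
  set d : subgroupH1 (localSubgroupOfEmb (κ.layerSubgroup n) (closureEmb (K := K) (v.adicCompletion K))) ↥(torsionPow M p k₁) :=
    torsIncl M p (localSubgroupOfEmb (κ.layerSubgroup n) (closureEmb (K := K) (v.adicCompletion K))) (le_max_left k j) ℓ - b₁ with hd
  have hd0 : torsToH1 M p _ k₁ d = 0 := by
    rw [hd, map_sub, torsToH1_torsIncl, hℓ, hb₁, torsToH1_map_comapSubtypeHom, torsToH1_torsIncl, hbj, sub_self]
  obtain ⟨k', hk', hdk⟩ := exists_torsIncl_eq_zero_of_torsToH1_eq_zero (localSubgroupOfEmb (κ.layerSubgroup n) (closureEmb (K := K) (v.adicCompletion K)))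
    (M := M) (fun m ↦ htor m) k₁ d hd0
  refine ⟨k', (le_max_left k j).trans hk', torsIncl M p (κ.layerSubgroup n) ((le_max_right k j).trans hk') bj, ?_, ?_⟩
  · rw [torsToH1_torsIncl, hbj]
  · rw [hd, map_sub, sub_eq_zero, hb₁, ← map_comapSubtypeHom_torsIncl] at hdk
    rw [← torsIncl_torsIncl _ (le_max_left k j) hk', hdk, torsIncl_torsIncl]

end Tors

end Summit.BirchSwinnertonDyer.BirchSwinnertonDyer.Theorems.SmallImageRttD2Seq

end
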